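import Mathlib
import HarnessLib

/-!
# Crux `DigitPolyUniformity` (stmt-QuantumAdvantage-1392), line `Sketch`, cycle 6 — Stub G2

Correlation with a two-ends test regroups into class sums: for `C' ≤ K ≤ h`, `K ≤ n`, `f` of period `2^K`
and `g` `1`-bounded, writing `N = r + 2^K s` (`r < 2^K`, `s < 2^{n-K}`) one has `f N = f r`,
`N mod 2^{C'} = r mod 2^{C'}` and `⌊N / 2^h⌋ = ⌊s / 2^{h-K}⌋`, whence
`|Σ_{N<2ⁿ} f(N) g(N mod 2^{C'}, ⌊N/2^h⌋)| ≤ 2^{n−K} Σ_{r₀<2^{C'}} |Σ_{r<2^K, r ≡ r₀} f(r)|`.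

(The hypothesis `K ≤ n` is necessary: for `K = 1`, `n = 0`, `C' = 0`, `h = 1`, `f = (-1)^r`, `g = 1` the
left side is `1` and the right side is `0`.)
-/

noncomputable section

namespace Summit.QuantumAdvantage.DigitPolyUniformity.SketchLAR.Chirp

open Finset

/-- Splitting a sum over `range (M * S)` along `N = r + M * s`, `r < M`, `s < S`. [folklore] -/
private lemma sum_range_mul_eq_sum_sum (F : ℕ → ℝ) (M S : ℕ) :
    ∑ N ∈ range (M * S), F N = ∑ s ∈ range S, ∑ r ∈ range M, F (r + M * s) := by
  induction S with
  | zero => simp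
  | succ S ih =>
    rw [Nat.mul_succ, Finset.sum_range_add, ih, Finset.sum_range_succ]
    congr 1
    exact Finset.sum_congr rfl (fun r _ => by rw [add_comm])

/-- **Stub G2 (correlation with a two-ends test regroups into class sums).** For `C' ≤ K ≤ h`, `K ≤ n`,
`f` of period `2^K` and `g` `1`-bounded, writing `N = r + 2^K s`:
`|Σ_{N<2ⁿ} f(N) g(N mod 2^{C'}, ⌊N/2^h⌋)| ≤ 2^{n−K} Σ_{r₀<2^{C'}} |Σ_{r<2^K, r ≡ r₀} f(r)|`. [folklore] -/
theorem stub_corr_le (f : ℕ → ℝ) (g : ℕ → ℕ → ℝ) (C' K h n : ℕ) (hC'K : C' ≤ K) (hKh : K ≤ h)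
    (hKn : K ≤ n) (hper : ∀ r, f (r % 2 ^ K) = f r) (hg : ∀ a b, |g a b| ≤ 1) :
    |∑ N ∈ range (2 ^ n), f N * g (N % 2 ^ C') (N / 2 ^ h)| ≤
      2 ^ (n - K) * ∑ r₀ ∈ range (2 ^ C'), |∑ r ∈ (range (2 ^ K)).filter (fun r => r % 2 ^ C' = r₀), f r| := by
  have h2n : 2 ^ n = 2 ^ K * 2 ^ (n - K) := by rw [← pow_add, Nat.add_sub_cancel' hKn]
  have h2h : 2 ^ h = 2 ^ K * 2 ^ (h - K) := by rw [← pow_add, Nat.add_sub_cancel' hKh]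
  have hCM : 2 ^ C' ∣ 2 ^ K := pow_dvd_pow 2 hC'K
  -- split `N = r + 2^K s` and simplify the summand
  have hinner : ∀ s ∈ range (2 ^ (n - K)),
      ∑ r ∈ range (2 ^ K), f (r + 2 ^ K * s) * g ((r + 2 ^ K * s) % 2 ^ C') ((r + 2 ^ K * s) / 2 ^ h) =
      ∑ r₀ ∈ range (2 ^ C'),
        g r₀ (s / 2 ^ (h - K)) * ∑ r ∈ (range (2 ^ K)).filter (fun r => r % 2 ^ C' = r₀), f r := by
    intro s _
    have hpt : ∀ r ∈ range (2 ^ K),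
        f (r + 2 ^ K * s) * g ((r + 2 ^ K * s) % 2 ^ C') ((r + 2 ^ K * s) / 2 ^ h) =
        f r * g (r % 2 ^ C') (s / 2 ^ (h - K)) := by
      intro r hr
      rw [Finset.mem_range] at hr
      rw [← Nat.mod_mod_of_dvd (r + 2 ^ K * s) hCM, ← hper (r + 2 ^ K * s), Nat.add_mul_mod_self_left,
        Nat.mod_eq_of_lt hr, h2h, ← Nat.div_div_eq_div_mul, Nat.add_mul_div_left _ _ (Nat.two_pow_pos K),
        Nat.div_eq_of_lt hr, zero_add]
    rw [Finset.sum_congr rfl hpt]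
    have hfib := Finset.sum_fiberwise_of_maps_to (s := range (2 ^ K)) (t := range (2 ^ C'))
      (g := fun r => r % 2 ^ C') (fun r _ => Finset.mem_range.2 (Nat.mod_lt r (Nat.two_pow_pos C')))
      (fun r => f r * g (r % 2 ^ C') (s / 2 ^ (h - K)))
    rw [← hfib]
    refine Finset.sum_congr rfl (fun r₀ _ => ?_)
    rw [Finset.mul_sum]
    refine Finset.sum_congr rfl (fun r hr => ?_)
    rw [(Finset.mem_filter.1 hr).2, mul_comm]
  rw [h2n, sum_range_mul_eq_sum_sum _ (2 ^ K) (2 ^ (n - K)), Finset.sum_congr rfl hinner]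
  -- bound each outer term by the class sums
  calc |∑ s ∈ range (2 ^ (n - K)), ∑ r₀ ∈ range (2 ^ C'),
          g r₀ (s / 2 ^ (h - K)) * ∑ r ∈ (range (2 ^ K)).filter (fun r => r % 2 ^ C' = r₀), f r|
      ≤ ∑ s ∈ range (2 ^ (n - K)), |∑ r₀ ∈ range (2 ^ C'),
          g r₀ (s / 2 ^ (h - K)) * ∑ r ∈ (range (2 ^ K)).filter (fun r => r % 2 ^ C' = r₀), f r| :=
        Finset.abs_sum_le_sum_abs _ _
    _ ≤ ∑ _s ∈ range (2 ^ (n - K)), ∑ r₀ ∈ range (2 ^ C'),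
          |∑ r ∈ (range (2 ^ K)).filter (fun r => r % 2 ^ C' = r₀), f r| := by
        refine Finset.sum_le_sum (fun s _ => ?_)
        refine (Finset.abs_sum_le_sum_abs _ _).trans (Finset.sum_le_sum (fun r₀ _ => ?_))
        rw [abs_mul]
        calc |g r₀ (s / 2 ^ (h - K))| * |∑ r ∈ (range (2 ^ K)).filter (fun r => r % 2 ^ C' = r₀), f r|
            ≤ 1 * |∑ r ∈ (range (2 ^ K)).filter (fun r => r % 2 ^ C' = r₀), f r| :=
              mul_le_mul_of_nonneg_right (hg _ _) (abs_nonneg _)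
          _ = _ := one_mul _
    _ = 2 ^ (n - K) * ∑ r₀ ∈ range (2 ^ C'),
          |∑ r ∈ (range (2 ^ K)).filter (fun r => r % 2 ^ C' = r₀), f r| := by
        rw [Finset.sum_const, Finset.card_range, nsmul_eq_mul]
        push_cast
        ring

end Summit.QuantumAdvantage.DigitPolyUniformity.SketchLAR.Chirp

end
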